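import Mathlib

/-!
# `BalabanImbrieJaffe1984to88.BIJ88Quad535` — T. Bałaban, J. Imbrie, A. Jaffe, *Effective action and cluster properties of
the abelian Higgs model*, Commun. Math. Phys. **114** (1988) 257–315 [BalabanImbrieJaffe1988], §5.3 *First Gauge Field
Translation*, p. 280: the transformation **(5.3.5)** of the quadratic form `½⟨Λ₅′**f^{(k)}, σ_{k,loc}Λ₅′**f^{(k)}⟩` under the
splitting (5.3.2) of `f^{(k)}` into the parts inside and outside `Λ₁^{(k)**}` — `= 𝒬₁ + 𝒬₁′` — PROVED as the polarization
identity of a symmetric finite-range form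

statement-level skeleton of published theorems with citation tags; proofs where landed; nothing here is a claim about the Yang–Mills mass gap

PDF held: `paper:balaban1988-cmp114-bij-abelian-higgs-effective-action` (journal page = PDF page + 256).  Render read this
session: p. 280 = PDF 24 (`pages/original-p024-x2.png` of the p02 seat, G4 decode of the scan, read as image).

**What the paper prints (p. 280, verbatim).**  (5.3.2): *"Under the translation we have f^{(k)}(p) = Λ₁^{(k)**c}(ie_k)^{−1} log
u′(p)v(p′₀) + Λ₁^{(k)**}(∂A′ + L^{−2}Q^{e*}f)(p), (5.3.2)"*; then: *"The quadratic form f^{(k)} transforms into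
½⟨Λ₅^{(k−1)′**}f^{(k)}, σ_{k,loc}Λ₅^{(k−1)′**}f^{(k)}⟩ = ½⟨Λ₅^{(k−1)′**}Λ₁^{(k)**c}(ie_k)^{−1} log u(p)v(p′₀) + 2Λ₁^{(k)**}Λ₂^{(k)c**}(∂A′ +
L^{−2}Q^{e*}f), σ_{k,loc}Λ₅^{(k−1)′**}Λ₁^{(k)**c}(ie_k)^{−1} log u(p)v(p′₀)⟩ + ½⟨Λ₁^{(k)**}(∂A′ + L^{−2}Q^{e*}f), σ_{k,loc}Λ₁^{(k)**}(∂A′ +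
L^{−2}Q^{e*}f)⟩ = 𝒬₁ + 𝒬₁′. (5.3.5)"*.

**What is reproduced here (kernel-checked, zero `sorry`, no named facts).**  A finite index type `ι` of plaquettes, real
plaquette functions, a real symmetric kernel `σ` (print: `σ_{k,loc}`), regions as `Finset`s with `res Λ f` the restriction
(print: the characteristic-function prefixes `Λ₁^{(k)**}`, `Λ₅^{(k−1)′**}`, …), `g` standing for the outside part
`(ie_k)^{−1} log u(p)v(p′₀)` and `h` for the inside part `∂A′ + L^{−2}Q^{e*}f` of (5.3.2).
* DEFINITIONS (bodies = the printed brackets): `qform σ f g := ⟨f, σg⟩`, **`Q1`** (`𝒬₁ = ½⟨Λ₅Λ₁ᶜg + 2Λ₁Λ₂ᶜh, σΛ₅Λ₁ᶜg⟩`),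
  **`Q1prime`** (`𝒬₁′ = ½⟨Λ₁h, σΛ₁h⟩`).
* **`eq535`** — (5.3.5) PROVED: with `f^{(k)} = Λ₁ᶜg + Λ₁h` (5.3.2), `½⟨Λ₅f^{(k)}, σΛ₅f^{(k)}⟩ = 𝒬₁ + 𝒬₁′`, under: `σ` symmetric,
  `Λ₁ ⊆ Λ₅` (the inside region lies in `Λ₅^{(k−1)′**}`), and the RANGE hypothesis `σ(p, q) = 0` for `p ∈ Λ₂`, `q ∉ Λ₁` (the
  localized `σ_{k,loc}` does not couple `Λ₂^{(k)**}` to the complement of `Λ₁^{(k)**}` — the reason the cross term carries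
  `Λ₂^{(k)c**}`).  Mechanism: polarization `½⟨G+H, σ(G+H)⟩ = ½⟨G, σG⟩ + ⟨H, σG⟩ + ½⟨H, σH⟩` (`qform_symm`) and `⟨Λ₂H, σG⟩ = 0`
  (`mulVec_res_eq_zero_of_range`).

**Readings (declared).**  (i) the regions enter only through `Λ₁ ⊆ Λ₅` and the range hypothesis — which is how the print's
`Λ₂^{(k)c**}` arises (ranges of `σ_{k,loc}` vs. the collar between `Λ₂^{(k)}` and `Λ₁^{(k)c}`, (5.2.1)–(5.2.4)); (ii) real fields and
a real symmetric kernel (the form of (4.1) is real); (iii) `v(p′₀)`, `u`, `u′`, the block geometry of (5.3.2) are inside the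
abstract `g` — (5.3.2) itself is the DEFINITION of the two parts and is not re-derived.

**What is NOT claimed.**  (5.3.2)–(5.3.4) (the background field after translation; r16's `BIJ88Sect5StatementsPart3.transl531`,
`bg534`), (5.3.6)–(5.3.7) (the δ-functions), the smallness of `𝒬₁` (boundary term) used later, the range property of `σ_{k,loc}`
itself ((2.18)/(2.19), r18's rows); anything of B1–B16.  NOT summit progress; NOT continuum; NOT Clay.  Imports: Mathlib only;
no Summits import; sub-namespace `…BIJ88Quad535`; modifies nothing.  Cell `lit-balaban` Phase 2, seat p02 gen 4; row
C2.Eq5.3.1-5.3.7 (owner r16), member (5.3.5) «absent» → proved.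
-/

open scoped BigOperators Matrix

namespace Literature.MathematicalPhysics.QuantumFieldTheory.BalabanImbrieJaffe1984to88.BIJ88Quad535

variable {ι : Type*} [Fintype ι] [DecidableEq ι]

/-- restriction of a plaquette function to a region (the print's characteristic-function prefix `Λf`).
[cite: BalabanImbrieJaffe1988, (5.3.2) p.280] -/
def res (Λ : Finset ι) (f : ι → ℝ) : ι → ℝ := fun p => if p ∈ Λ then f p else 0

omit [Fintype ι] in
/-- `res` pointwise. [cite: BalabanImbrieJaffe1988, (5.3.2) p.280] -/
@[simp] theorem res_apply (Λ : Finset ι) (f : ι → ℝ) (p : ι) : res Λ f p = if p ∈ Λ then f p else 0 := rfl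

omit [Fintype ι] in
/-- nested regions: `Λ₅(Λ₁h) = Λ₁h` for `Λ₁ ⊆ Λ₅`. [cite: BalabanImbrieJaffe1988, (5.3.5) p.280] -/
theorem res_res_of_subset {Λ1 Λ5 : Finset ι} (h15 : Λ1 ⊆ Λ5) (f : ι → ℝ) : res Λ5 (res Λ1 f) = res Λ1 f := by
  funext p
  by_cases h1 : p ∈ Λ1
  · simp [h1, h15 h1]
  · simp [h1]

omit [Fintype ι] in
/-- restrictions commute. [cite: BalabanImbrieJaffe1988, (5.3.5) p.280] -/
theorem res_comm (Λ Λ' : Finset ι) (f : ι → ℝ) : res Λ (res Λ' f) = res Λ' (res Λ f) := by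
  funext p
  by_cases h1 : p ∈ Λ <;> by_cases h2 : p ∈ Λ' <;> simp [h1, h2]

omit [Fintype ι] in
/-- `res` is additive. [cite: BalabanImbrieJaffe1988, (5.3.2) p.280] -/
theorem res_add (Λ : Finset ι) (f g : ι → ℝ) : res Λ (f + g) = res Λ f + res Λ g := by
  funext p
  by_cases h1 : p ∈ Λ <;> simp [h1]

omit [Fintype ι] in
/-- `h = Λ₂h + Λ₂ᶜh`. [cite: BalabanImbrieJaffe1988, (5.3.5) p.280] -/
theorem res_add_res_compl (Λ : Finset ι) [Fintype ι] (f : ι → ℝ) : res Λ f + res Λᶜ f = f := by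
  funext p
  by_cases h1 : p ∈ Λ <;> simp [h1]

/-- the bilinear form `⟨f, σg⟩ = Σ_p f(p) (σg)(p)`. [cite: BalabanImbrieJaffe1988, (5.3.5) p.280] -/
def qform (σ : Matrix ι ι ℝ) (f g : ι → ℝ) : ℝ := f ⬝ᵥ (σ *ᵥ g)

omit [DecidableEq ι] in
/-- symmetry of the form for a symmetric kernel: `⟨f, σg⟩ = ⟨g, σf⟩`. [cite: BalabanImbrieJaffe1988, (5.3.5) p.280] -/
theorem qform_symm {σ : Matrix ι ι ℝ} (hσ : σ.IsSymm) (f g : ι → ℝ) : qform σ f g = qform σ g f := by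
  rw [qform, qform, Matrix.dotProduct_mulVec, ← Matrix.mulVec_transpose, hσ.eq, dotProduct_comm]

/-- the range mechanism: if `σ` does not couple `Λ₂` to the outside of `Λ₁` and `G` vanishes on `Λ₁`, then `σG` vanishes on `Λ₂`,
so `⟨Λ₂H, σG⟩ = 0`. [cite: BalabanImbrieJaffe1988, (5.3.5) p.280] -/
theorem qform_res_eq_zero_of_range {σ : Matrix ι ι ℝ} {Λ1 Λ2 : Finset ι} (hrange : ∀ p ∈ Λ2, ∀ q ∉ Λ1, σ p q = 0)
    {G : ι → ℝ} (hG : ∀ q ∈ Λ1, G q = 0) (H : ι → ℝ) : qform σ (res Λ2 H) G = 0 := by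
  unfold qform dotProduct
  refine Finset.sum_eq_zero fun p _ => ?_
  by_cases hp : p ∈ Λ2
  · have hσG : (σ *ᵥ G) p = 0 := by
      change ∑ q, σ p q * G q = 0
      refine Finset.sum_eq_zero fun q _ => ?_
      by_cases hq : q ∈ Λ1
      · rw [hG q hq, mul_zero]
      · rw [hrange p hp q hq, zero_mul]
    rw [hσG, mul_zero]
  · simp [hp]

/-- **`𝒬₁`** of (5.3.5): `½⟨Λ₅Λ₁ᶜg + 2Λ₁Λ₂ᶜh, σ_{k,loc}Λ₅Λ₁ᶜg⟩` (the terms containing the outside part `g`).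
[cite: BalabanImbrieJaffe1988, (5.3.5) p.280] -/
noncomputable def Q1 (σ : Matrix ι ι ℝ) (Λ1 Λ2 Λ5 : Finset ι) (g h : ι → ℝ) : ℝ :=
  (1 / 2) * qform σ (res Λ5 (res Λ1ᶜ g) + 2 • res Λ1 (res Λ2ᶜ h)) (res Λ5 (res Λ1ᶜ g))

/-- **`𝒬₁′`** of (5.3.5): `½⟨Λ₁h, σ_{k,loc}Λ₁h⟩` (the purely inside term). [cite: BalabanImbrieJaffe1988, (5.3.5) p.280] -/
noncomputable def Q1prime (σ : Matrix ι ι ℝ) (Λ1 : Finset ι) (h : ι → ℝ) : ℝ :=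
  (1 / 2) * qform σ (res Λ1 h) (res Λ1 h)

/-- **(5.3.5)** p. 280 [PDF 24] — PROVED: for a symmetric kernel `σ` that does not couple `Λ₂` to the complement of `Λ₁`, and
`Λ₁ ⊆ Λ₅`, the form of `f^{(k)} = Λ₁ᶜg + Λ₁h` restricted to `Λ₅` splits as printed:
`½⟨Λ₅f^{(k)}, σΛ₅f^{(k)}⟩ = 𝒬₁ + 𝒬₁′`. [cite: BalabanImbrieJaffe1988, (5.3.5) p.280] -/
theorem eq535 {σ : Matrix ι ι ℝ} (hσ : σ.IsSymm) {Λ1 Λ2 Λ5 : Finset ι} (h15 : Λ1 ⊆ Λ5)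
    (hrange : ∀ p ∈ Λ2, ∀ q ∉ Λ1, σ p q = 0) (g h : ι → ℝ) :
    (1 / 2) * qform σ (res Λ5 (res Λ1ᶜ g + res Λ1 h)) (res Λ5 (res Λ1ᶜ g + res Λ1 h))
      = Q1 σ Λ1 Λ2 Λ5 g h + Q1prime σ Λ1 h := by
  -- names for the two parts after restriction to Λ₅
  set G : ι → ℝ := res Λ5 (res Λ1ᶜ g) with hGdef
  set H : ι → ℝ := res Λ1 h with hHdef
  have hsplit : res Λ5 (res Λ1ᶜ g + res Λ1 h) = G + H := by
    rw [res_add, res_res_of_subset h15]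
  -- G vanishes on Λ₁
  have hG : ∀ q ∈ Λ1, G q = 0 := fun q hq => by
    simp [hGdef, hq]
  -- the cross term only sees Λ₂ᶜH
  have hcross : qform σ H G = qform σ (res Λ2ᶜ H) G := by
    conv_lhs => rw [← res_add_res_compl Λ2 H]
    rw [qform, add_dotProduct, ← qform, ← qform, qform_res_eq_zero_of_range hrange hG H, zero_add]
  have hcomm : res Λ1 (res Λ2ᶜ h) = res Λ2ᶜ H := by rw [hHdef, res_comm]
  -- expand both sides
  rw [hsplit, Q1, Q1prime, hcomm]
  simp only [qform, add_dotProduct, dotProduct_add, Matrix.mulVec_add, smul_dotProduct] at hcross ⊢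
  have hsym : G ⬝ᵥ σ *ᵥ H = H ⬝ᵥ σ *ᵥ G := qform_symm hσ G H
  rw [hsym, hcross]
  ring

/-! ## Non-vacuity -/

/-- On a two-plaquette index set with `Λ₁ = Λ₂ = Λ₅ = {0}` and the diagonal kernel `σ = 1` (which couples nothing), the
hypotheses of `eq535` hold. -/
example (g h : Fin 2 → ℝ) :
    (1 / 2) * qform (1 : Matrix (Fin 2) (Fin 2) ℝ) (res {0} (res {0}ᶜ g + res {0} h)) (res {0} (res {0}ᶜ g + res {0} h))
      = Q1 1 {0} {0} {0} g h + Q1prime 1 {0} h :=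
  eq535 Matrix.isSymm_one subset_rfl (fun p hp q hq => by
    rw [Finset.mem_singleton] at hp
    have hq' : q ≠ 0 := fun e => hq (Finset.mem_singleton.mpr e)
    rw [Matrix.one_apply_ne (by rw [hp]; exact hq'.symm)]) g h

end Literature.MathematicalPhysics.QuantumFieldTheory.BalabanImbrieJaffe1984to88.BIJ88Quad535
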